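import Summits.CriticalPhenomena.PercolationContinuityZ3.Theorems.PercNearOneGluingNoHeavyLowerTailSunflowerLatinMaster
import HarnessLib

/-!
# `NoHeavyLowerTail` (crux stmt-CriticalPhenomena-4575), abstract sunflower cubic: the POLARISED RECURSION of the Latin master functional

Support file (seat `prim-l12-p2` gen 10; `--supports stmt-CriticalPhenomena-4575`; companion of `…SunflowerLatinMaster` (p235079)).  No `sorry`, no
named facts, nothing asserted about the crux.  Memo: run/shared/lean/prim/prim-l12/prim-l12-p2/FINDING-g10-LATIN-MASTER.md §4(e).

For a kernel `κ` and three maps `A B C : (β → Fin 3) → Fin 5` the POLARISED (trilinear) Latin functional is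
`latinT3 κ A B C = Σ_{σ : β → S₃} κ (A (σ·0)) (B (σ·1)) (C (σ·2))` (`latinT κ G = latinT3 κ G G G`, `latinT3_self`).  Adding one coordinate
(`Option β`), with the three SECTIONS `G.osec l = G(·, x_none = l)`:
* `latinT_option` — **`latinT κ G = Σ_{π ∈ S₃} latinT3 κ (G.osec (π 0)) (G.osec (π 1)) (G.osec (π 2))`**;
* `latinT3_swap12/23` — `latinT3` is symmetric in its three arguments for every kernel symmetric in its arguments (`s6H`, `s6G`, `s6T`:
  `s6G_perm` etc. by `decide`), hence
* `latinT_option_eq_six_mul` — **`latinT κ G = 6 · latinT3 κ (G.osec 0) (G.osec 1) (G.osec 2)`** for `κ ∈ {s6H, s6G, s6T}`: the Latin master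
  conjecture is equivalent to the nonnegativity of the polarised functional on POINTWISE CHAINS `A ≤ B ≤ C` of monotone maps (the sections of a
  monotone `G` form such a chain, and every chain arises so).  This is the ternary analogue of the two-line exchange proof of antipodal Gladkov
  (`Sunflower.antipodal_sum_nonneg`); the memo's no-go (N4) shows that, unlike the binary case, NO pointwise inequality closes this recursion
  from chain-positivity alone (exact LP, kit j106204).
-/

namespace Summit.CriticalPhenomena.PercolationContinuityZ3.Theorems.SunflowerPartition

open Finset

section Recursion

variable {β : Type*} [Fintype β] [DecidableEq β]

/-- The polarised (trilinear) Latin functional: three maps, one per copy. [this work] -/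
def latinT3 (κ : Fin 5 → Fin 5 → Fin 5 → ℤ) (A B C : (β → Fin 3) → Fin 5) : ℤ :=
  ∑ σ : β → Equiv.Perm (Fin 3), κ (A (lpt σ 0)) (B (lpt σ 1)) (C (lpt σ 2))

/-- `latinT` is the diagonal of `latinT3`. [this work] -/
theorem latinT3_self (κ : Fin 5 → Fin 5 → Fin 5 → ℤ) (G : (β → Fin 3) → Fin 5) : latinT3 κ G G G = latinT κ G := rfl

/-- The section of a map on the cube over `Option β` at level `l` of the new coordinate `none`. [this work] -/
def osec (G : (Option β → Fin 3) → Fin 5) (l : Fin 3) : (β → Fin 3) → Fin 5 := fun x => G fun o => o.elim l x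

omit [Fintype β] [DecidableEq β] in
/-- Splitting a permutation family on `Option β` into its `none` component and its restriction: the Latin points factor accordingly.
[this work] -/
theorem lpt_option (π : Equiv.Perm (Fin 3)) (σ : β → Equiv.Perm (Fin 3)) (t : Fin 3) :
    lpt (fun o : Option β => o.elim π σ) t = fun o => o.elim (π t) (lpt σ t) := by
  funext o
  cases o <;> rfl

/-- **Polarised recursion**: `latinT κ G = Σ_{π ∈ S₃} latinT3 κ (G.osec (π 0)) (G.osec (π 1)) (G.osec (π 2))`. [this work] -/
theorem latinT_option (κ : Fin 5 → Fin 5 → Fin 5 → ℤ) (G : (Option β → Fin 3) → Fin 5) :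
    latinT κ G = ∑ π : Equiv.Perm (Fin 3), latinT3 κ (osec G (π 0)) (osec G (π 1)) (osec G (π 2)) := by
  unfold latinT latinT3
  rw [← (Equiv.piOptionEquivProd (β := fun _ : Option β => Equiv.Perm (Fin 3))).symm.sum_comp]
  rw [Fintype.sum_prod_type]
  refine sum_congr rfl fun π _ => sum_congr rfl fun σ _ => ?_
  have h : ∀ t, G (lpt ((Equiv.piOptionEquivProd (β := fun _ : Option β => Equiv.Perm (Fin 3))).symm (π, σ)) t) = osec G (π t) (lpt σ t) := by
    intro t
    have : ((Equiv.piOptionEquivProd (β := fun _ : Option β => Equiv.Perm (Fin 3))).symm (π, σ)) = fun o => o.elim π σ := by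
      funext o; cases o <;> rfl
    rw [this, lpt_option]
    rfl
  rw [h 0, h 1, h 2]

/-- The kernels are invariant under permuting their arguments (transpositions suffice). [this work] -/
theorem s6G_swap12 : ∀ x y z : Fin 5, s6G x y z = s6G y x z := by decide
/-- [this work] -/
theorem s6G_swap23 : ∀ x y z : Fin 5, s6G x y z = s6G x z y := by decide
/-- [this work] -/
theorem s6T_swap12 : ∀ x y z : Fin 5, s6T x y z = s6T y x z := by decide
/-- [this work] -/
theorem s6T_swap23 : ∀ x y z : Fin 5, s6T x y z = s6T x z y := by decide

omit [Fintype β] [DecidableEq β] in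
/-- Right-multiplying every permutation of the family by a fixed `τ` relabels the three Latin points by `τ`. [this work] -/
theorem lpt_mul (σ : β → Equiv.Perm (Fin 3)) (τ : Equiv.Perm (Fin 3)) (t : Fin 3) :
    lpt (fun b => σ b * τ) t = lpt σ (τ t) := by
  funext b; rfl

/-- `latinT3` is symmetric in its first two arguments (kernel symmetric in its first two arguments). [this work] -/
theorem latinT3_swap12 (κ : Fin 5 → Fin 5 → Fin 5 → ℤ) (hκ : ∀ x y z, κ x y z = κ y x z) (A B C : (β → Fin 3) → Fin 5) :
    latinT3 κ A B C = latinT3 κ B A C := by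
  unfold latinT3
  let τ : Equiv.Perm (Fin 3) := Equiv.swap 0 1
  rw [← (Equiv.piCongrRight fun _ : β => Equiv.mulRight τ).sum_comp]
  refine sum_congr rfl fun σ _ => ?_
  have e : (Equiv.piCongrRight fun _ : β => Equiv.mulRight τ) σ = fun b => σ b * τ := rfl
  rw [e, lpt_mul, lpt_mul, lpt_mul]
  have h0 : τ 0 = 1 := by decide
  have h1 : τ 1 = 0 := by decide
  have h2 : τ 2 = 2 := by decide
  rw [h0, h1, h2, hκ]

/-- `latinT3` is symmetric in its last two arguments (kernel symmetric in its last two arguments). [this work] -/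
theorem latinT3_swap23 (κ : Fin 5 → Fin 5 → Fin 5 → ℤ) (hκ : ∀ x y z, κ x y z = κ x z y) (A B C : (β → Fin 3) → Fin 5) :
    latinT3 κ A B C = latinT3 κ A C B := by
  unfold latinT3
  let τ : Equiv.Perm (Fin 3) := Equiv.swap 1 2
  rw [← (Equiv.piCongrRight fun _ : β => Equiv.mulRight τ).sum_comp]
  refine sum_congr rfl fun σ _ => ?_
  have e : (Equiv.piCongrRight fun _ : β => Equiv.mulRight τ) σ = fun b => σ b * τ := rfl
  rw [e, lpt_mul, lpt_mul, lpt_mul]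
  have h0 : τ 0 = 0 := by decide
  have h1 : τ 1 = 2 := by decide
  have h2 : τ 2 = 1 := by decide
  rw [h0, h1, h2, hκ]

/-- For a fully symmetric kernel, all six orderings of the arguments of `latinT3` agree with the sorted one. [this work] -/
theorem latinT3_perm (κ : Fin 5 → Fin 5 → Fin 5 → ℤ) (h12 : ∀ x y z, κ x y z = κ y x z) (h23 : ∀ x y z, κ x y z = κ x z y)
    (S : Fin 3 → (β → Fin 3) → Fin 5) :
    ∀ π : Equiv.Perm (Fin 3), latinT3 κ (S (π 0)) (S (π 1)) (S (π 2)) = latinT3 κ (S 0) (S 1) (S 2) := by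
  have key : ∀ a b c : Fin 3, ({a, b, c} : Finset (Fin 3)) = {0, 1, 2} →
      latinT3 κ (S a) (S b) (S c) = latinT3 κ (S 0) (S 1) (S 2) := by
    intro a b c habc
    -- enumerate the six cases
    have : (a = 0 ∧ b = 1 ∧ c = 2) ∨ (a = 0 ∧ b = 2 ∧ c = 1) ∨ (a = 1 ∧ b = 0 ∧ c = 2) ∨ (a = 1 ∧ b = 2 ∧ c = 0) ∨
        (a = 2 ∧ b = 0 ∧ c = 1) ∨ (a = 2 ∧ b = 1 ∧ c = 0) := by
      revert a b c; decide
    rcases this with ⟨rfl, rfl, rfl⟩ | ⟨rfl, rfl, rfl⟩ | ⟨rfl, rfl, rfl⟩ | ⟨rfl, rfl, rfl⟩ | ⟨rfl, rfl, rfl⟩ | ⟨rfl, rfl, rfl⟩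
    · rfl
    · rw [latinT3_swap23 κ h23 (S 0) (S 2) (S 1)]
    · rw [latinT3_swap12 κ h12 (S 1) (S 0) (S 2)]
    · rw [latinT3_swap23 κ h23 (S 1) (S 2) (S 0), latinT3_swap12 κ h12 (S 1) (S 0) (S 2)]
    · rw [latinT3_swap12 κ h12 (S 2) (S 0) (S 1), latinT3_swap23 κ h23 (S 0) (S 2) (S 1)]
    · rw [latinT3_swap12 κ h12 (S 2) (S 1) (S 0), latinT3_swap23 κ h23 (S 1) (S 2) (S 0), latinT3_swap12 κ h12 (S 1) (S 0) (S 2)]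
  intro π
  apply key
  have hs : Function.Surjective π := π.surjective
  ext t
  simp only [mem_insert, mem_singleton]
  constructor
  · intro _
    rcases t with ⟨i, hi⟩
    interval_cases i <;> simp
  · intro _
    obtain ⟨s, hs'⟩ := hs t
    have : s = 0 ∨ s = 1 ∨ s = 2 := by rcases s with ⟨i, hi⟩; interval_cases i <;> simp
    rcases this with rfl | rfl | rfl
    · exact Or.inl hs'.symm
    · exact Or.inr (Or.inl hs'.symm)
    · exact Or.inr (Or.inr hs'.symm)

/-- **`latinT κ G = 6 · latinT3 κ G₀ G₁ G₂`** for a fully symmetric kernel (`G_l` the three sections of the new coordinate). [this work] -/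
theorem latinT_option_eq_six_mul (κ : Fin 5 → Fin 5 → Fin 5 → ℤ) (h12 : ∀ x y z, κ x y z = κ y x z) (h23 : ∀ x y z, κ x y z = κ x z y)
    (G : (Option β → Fin 3) → Fin 5) :
    latinT κ G = 6 * latinT3 κ (osec G 0) (osec G 1) (osec G 2) := by
  rw [latinT_option]
  have hc : ∀ π : Equiv.Perm (Fin 3), latinT3 κ (osec G (π 0)) (osec G (π 1)) (osec G (π 2)) = latinT3 κ (osec G 0) (osec G 1) (osec G 2) :=
    latinT3_perm κ h12 h23 (osec G)
  simp_rw [hc]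
  rw [sum_const, card_univ, Fintype.card_perm, Fintype.card_fin]
  norm_num

/-- The `G`-row instance: `latinT s6G G = 6 · latinT3 s6G G₀ G₁ G₂`. [this work] -/
theorem latinT_s6G_option (G : (Option β → Fin 3) → Fin 5) :
    latinT s6G G = 6 * latinT3 s6G (osec G 0) (osec G 1) (osec G 2) :=
  latinT_option_eq_six_mul s6G s6G_swap12 s6G_swap23 G

/-- The `T`-row instance. [this work] -/
theorem latinT_s6T_option (G : (Option β → Fin 3) → Fin 5) :
    latinT s6T G = 6 * latinT3 s6T (osec G 0) (osec G 1) (osec G 2) :=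
  latinT_option_eq_six_mul s6T s6T_swap12 s6T_swap23 G

/-- The `H`-row instance (`s6H_symm` from `…SunflowerPartitionLemma`). [this work] -/
theorem latinT_s6H_option (G : (Option β → Fin 3) → Fin 5) :
    latinT s6H G = 6 * latinT3 s6H (osec G 0) (osec G 1) (osec G 2) :=
  latinT_option_eq_six_mul s6H (fun x y z => (s6H_symm x y z).1) (fun x y z => (s6H_symm x y z).2) G

omit [Fintype β] [DecidableEq β] in
/-- **Sections of a monotone map form a pointwise chain** in `M₃`: `G₀ ≤ G₁ ≤ G₂`. [this work] -/
theorem osec_chain (G : (Option β → Fin 3) → Fin 5)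
    (hG : ∀ ⦃x y : Option β → Fin 3⦄, x ≤ y → (G x = G y ∨ G x = 0 ∨ G y = 4)) (l l' : Fin 3) (hll : l ≤ l') (x : β → Fin 3) :
    osec G l x = osec G l' x ∨ osec G l x = 0 ∨ osec G l' x = 4 := by
  apply hG
  intro o
  cases o with
  | none => exact hll
  | some b => exact le_rfl

/-! ## The polarised form of the conjecture -/

/-- Transitivity of the diamond order (written as the usual disjunction). [this work] -/
theorem le3_trans : ∀ a b c : Fin 5, (a = b ∨ a = 0 ∨ b = 4) → (b = c ∨ b = 0 ∨ c = 4) → (a = c ∨ a = 0 ∨ c = 4) := by decide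

/-- Gluing a chain of three maps on `β → Fin 3` into one map on `Option β → Fin 3` (the new coordinate `none` selects the map). [this work] -/
def glue3 (A B C : (β → Fin 3) → Fin 5) : (Option β → Fin 3) → Fin 5 := fun x => (![A, B, C] (x none)) fun b => x (some b)

omit [Fintype β] [DecidableEq β] in
/-- The sections of the glued map are the three maps. [this work] -/
theorem osec_glue3 (A B C : (β → Fin 3) → Fin 5) :
    osec (glue3 A B C) 0 = A ∧ osec (glue3 A B C) 1 = B ∧ osec (glue3 A B C) 2 = C := by
  refine ⟨?_, ?_, ?_⟩ <;> funext x <;> rfl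

omit [Fintype β] [DecidableEq β] in
/-- The glued map of a pointwise chain `A ≤ B ≤ C` of monotone maps is monotone. [this work] -/
theorem glue3_mono (A B C : (β → Fin 3) → Fin 5)
    (hA : ∀ ⦃u v : β → Fin 3⦄, u ≤ v → (A u = A v ∨ A u = 0 ∨ A v = 4))
    (hB : ∀ ⦃u v : β → Fin 3⦄, u ≤ v → (B u = B v ∨ B u = 0 ∨ B v = 4))
    (hC : ∀ ⦃u v : β → Fin 3⦄, u ≤ v → (C u = C v ∨ C u = 0 ∨ C v = 4))
    (hAB : ∀ u, A u = B u ∨ A u = 0 ∨ B u = 4) (hBC : ∀ u, B u = C u ∨ B u = 0 ∨ C u = 4) :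
    ∀ ⦃x y : Option β → Fin 3⦄, x ≤ y → (glue3 A B C x = glue3 A B C y ∨ glue3 A B C x = 0 ∨ glue3 A B C y = 4) := by
  intro x y hxy
  have hn : x none ≤ y none := hxy none
  have hs : (fun b => x (some b)) ≤ fun b => y (some b) := fun b => hxy (some b)
  -- value of the selector at `x none` and `y none`
  have cases3 : ∀ t : Fin 3, t = 0 ∨ t = 1 ∨ t = 2 := by decide
  unfold glue3
  rcases cases3 (x none) with hx | hx | hx <;> rcases cases3 (y none) with hy | hy | hy <;> rw [hx, hy] <;>
    simp only [Matrix.cons_val_zero, Matrix.cons_val_one, Matrix.cons_val]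
  · exact hA hs
  · exact le3_trans _ _ _ (hA hs) (hAB _)
  · exact le3_trans _ _ _ (le3_trans _ _ _ (hA hs) (hAB _)) (hBC _)
  · exfalso; rw [hx, hy] at hn; exact absurd hn (by decide)
  · exact hB hs
  · exact le3_trans _ _ _ (hB hs) (hBC _)
  · exfalso; rw [hx, hy] at hn; exact absurd hn (by decide)
  · exfalso; rw [hx, hy] at hn; exact absurd hn (by decide)
  · exact hC hs

/-- **`LatinMasterG` in polarised form**: it gives `0 ≤ latinT3 s6G A B C` for every pointwise chain `A ≤ B ≤ C` of monotone ternary-cube maps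
(conversely `latinT_s6G_option` + `osec_chain` recover `LatinMasterG` on every cube with a distinguished coordinate). [this work] -/
theorem latinT3_nonneg_of_latinMasterG (h : LatinMasterG) {β : Type} [Fintype β] [DecidableEq β] (A B C : (β → Fin 3) → Fin 5)
    (hA : ∀ ⦃u v : β → Fin 3⦄, u ≤ v → (A u = A v ∨ A u = 0 ∨ A v = 4))
    (hB : ∀ ⦃u v : β → Fin 3⦄, u ≤ v → (B u = B v ∨ B u = 0 ∨ B v = 4))
    (hC : ∀ ⦃u v : β → Fin 3⦄, u ≤ v → (C u = C v ∨ C u = 0 ∨ C v = 4))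
    (hAB : ∀ u, A u = B u ∨ A u = 0 ∨ B u = 4) (hBC : ∀ u, B u = C u ∨ B u = 0 ∨ C u = 4) :
    0 ≤ latinT3 s6G A B C := by
  have h1 := h (Option β) (glue3 A B C) (glue3_mono A B C hA hB hC hAB hBC)
  rw [latinT_s6G_option] at h1
  obtain ⟨e0, e1, e2⟩ := osec_glue3 A B C
  rw [e0, e1, e2] at h1
  linarith

/-- Conversely, polarised nonnegativity on `β` gives the conjecture's inequality on `Option β`. [this work] -/
theorem latinT_s6G_nonneg_of_polar {β : Type*} [Fintype β] [DecidableEq β]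
    (hpol : ∀ (A B C : (β → Fin 3) → Fin 5), (∀ u, A u = B u ∨ A u = 0 ∨ B u = 4) → (∀ u, B u = C u ∨ B u = 0 ∨ C u = 4) →
      0 ≤ latinT3 s6G A B C)
    (G : (Option β → Fin 3) → Fin 5) (hG : ∀ ⦃x y : Option β → Fin 3⦄, x ≤ y → (G x = G y ∨ G x = 0 ∨ G y = 4)) :
    0 ≤ latinT s6G G := by
  rw [latinT_s6G_option]
  have h01 := osec_chain G hG 0 1 (by decide)
  have h12 := osec_chain G hG 1 2 (by decide)
  have := hpol (osec G 0) (osec G 1) (osec G 2) h01 h12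
  linarith

end Recursion

end Summit.CriticalPhenomena.PercolationContinuityZ3.Theorems.SunflowerPartition
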